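import Summits.NavierStokesRegularity.NavierStokesRegularity.Theorems.AdaptedFrequencyAdaptedKernelExistsLowerOfUpperBridge
import Literature.Analysis.FluidPDE.DriftHeatInteriorLipschitz

/-!
# Crux `AdaptedKernelExists` (stmt-NavierStokesRegularity-2956), line `nash-entropy-last-block`:
  STUB `stub_kernelLimit`, part 2 — spatial equicontinuity of adapted kernels

Helper file (lands `--supports stmt-NavierStokesRegularity-2956`) on the proof path of the
registered stub `stub_kernelLimit`.  For ONE adapted backward kernel `G` of `∂ₜ + b·∇ − νΔ` on
`Ico tₘ T` the tree's interior Lipschitz estimate of Ishii–Lions type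
(`IsDriftHeatSolutionOn.abs_sub_le_lipConst`, `DriftHeatInteriorLipschitz`), applied to the
reversed and rescaled kernel of the landed bridge `lowerOfUpper_bridge`, gives a modulus of
continuity of the slice `G(t, ·)` at any point which depends on the kernel ONLY through a drift
bound `Bd` and a sup bound `M` on the block `[t, t + τ]`:

* `kernelLimit_space_lipschitz` — `|G(t, y) − G(t, c)| ≤ lipConst (Bd/ν) ρ n · M · ‖y − c‖`
  for `‖y − c‖ ≤ lipRad (Bd/ν) ρ`, whenever `ρ² ≤ ντ`, `‖b‖ ≤ Bd` and `|G| ≤ M` on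
  `[t, t + τ] × E`;
* `kernelLimit_space_modulus` — the `ε`–`δ` form: for every `ε > 0` there is `δ > 0`, depending
  only on `(ν, Bd, M, τ, ε, n)`, with `|G(t, y) − G(t, c)| ≤ ε` for `‖y − c‖ ≤ δ`.

This is the spatial EQUICONTINUITY used to extract a pointwise limit from a family of kernels
with common Gaussian bounds.
-/

noncomputable section

open MeasureTheory Set Filter Topology Metric Function
open scoped Laplacian
open Literature.Analysis.FluidPDE

namespace Summit.NavierStokesRegularity.NavierStokesRegularity.Theorems.AdaptedKernelExists.NashEntropyLastBlock

section General

variable {E : Type*} [NormedAddCommGroup E] [InnerProductSpace ℝ E] [FiniteDimensional ℝ E]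
  [MeasurableSpace E] [BorelSpace E]

/-- **Interior spatial Lipschitz bound for an adapted kernel.**  Let `G` be an adapted backward
kernel of `∂ₜ + b·∇ − νΔ` on `Ico tₘ T` (`ν > 0`, `b` jointly smooth), `[t, t + τ] ⊂ (tₘ, T)` an
interior block on which `‖b‖ ≤ Bd` and `|G| ≤ M` (`M > 0`), and `0 < ρ` with `ρ² ≤ ντ`.  Then for
every centre `c` and every `y` with `‖y − c‖ ≤ lipRad (Bd/ν) ρ`,
`|G(t, y) − G(t, c)| ≤ lipConst (Bd/ν) ρ n · M · ‖y − c‖` (`n = dim E`): the reversed kernel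
`σ ↦ G(t + τ − σ/ν)` is in the local drift–heat class on `[0, ντ]` (`lowerOfUpper_bridge`) and the
tree's `IsDriftHeatSolutionOn.abs_sub_le_lipConst` applies at the final time `σ = ντ`. -/
theorem kernelLimit_space_lipschitz {ν tₘ T t τ Bd M ρ : ℝ} {b : ℝ → E → E} {x₀ : E}
    {G : ℝ → E → ℝ} (hν : 0 < ν) (ht : tₘ < t) (hτ : 0 < τ) (htT : t + τ < T)
    (hb : IsSmoothSpaceTimeOn (Ico tₘ T) b) (hBd : ∀ s ∈ Icc t (t + τ), ∀ x, ‖b s x‖ ≤ Bd)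
    (hG : IsAdaptedBackwardKernel ν b (Ico tₘ T) T x₀ G) (hM : 0 < M)
    (hGM : ∀ s ∈ Icc t (t + τ), ∀ x, |G s x| ≤ M) (hρ : 0 < ρ) (hρτ : ρ ^ 2 ≤ ν * τ) (c : E) :
    ∀ y, ‖y - c‖ ≤ lipRad (Bd / ν) ρ →
      |G t y - G t c| ≤ lipConst (Bd / ν) ρ (Module.finrank ℝ E) * M * ‖y - c‖ := by
  obtain ⟨a, hv⟩ := lowerOfUpper_bridge hν ht hτ htT hb hBd hG
  have hστ : 0 < ν * τ := mul_pos hν hτ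
  have hS : Icc (ν * τ - ρ ^ 2) (ν * τ) ⊆ Icc 0 (ν * τ) :=
    Icc_subset_Icc (by nlinarith) le_rfl
  have hbd : ∀ σ ∈ Icc (ν * τ - ρ ^ 2) (ν * τ), ∀ x ∈ closedBall c (2 * ρ),
      |G (t + τ - σ / ν) x| ≤ M := by
    intro σ hσ x _
    have hσ' : σ ∈ Icc 0 (ν * τ) := hS hσ
    exact hGM _ (lowerOfUpper_clamp hν hσ').2 x
  have key := hv.abs_sub_le_lipConst isOpen_univ (x₀ := c) (t₀ := ν * τ) hρ hM
    (subset_univ _) hS hbd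
  have e1 : t + τ - ν * τ / ν = t := by field_simp; ring
  intro y hy
  have := key y (mem_closedBall.2 (by rwa [dist_eq_norm]))
  simpa only [e1] using this

/-- **Spatial modulus of continuity, uniform in the kernel.**  In the situation of
`kernelLimit_space_lipschitz`, for every `ε > 0` the radius
`δ = min (lipRad (Bd/ν) ρ) (ε / (lipConst (Bd/ν) ρ n · M + 1))` — which depends on the kernel only
through `(ν, Bd, M, ρ)` — satisfies `|G(t, y) − G(t, c)| ≤ ε` whenever `‖y − c‖ ≤ δ`. -/
theorem kernelLimit_space_modulus {ν tₘ T t τ Bd M ρ ε : ℝ} {b : ℝ → E → E} {x₀ : E}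
    {G : ℝ → E → ℝ} (hν : 0 < ν) (ht : tₘ < t) (hτ : 0 < τ) (htT : t + τ < T)
    (hb : IsSmoothSpaceTimeOn (Ico tₘ T) b) (hBd : ∀ s ∈ Icc t (t + τ), ∀ x, ‖b s x‖ ≤ Bd)
    (hBd0 : 0 ≤ Bd) (hG : IsAdaptedBackwardKernel ν b (Ico tₘ T) T x₀ G) (hM : 0 < M)
    (hGM : ∀ s ∈ Icc t (t + τ), ∀ x, |G s x| ≤ M) (hρ : 0 < ρ) (hρτ : ρ ^ 2 ≤ ν * τ)
    (hε : 0 < ε) (c y : E)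
    (hy : ‖y - c‖ ≤ min (lipRad (Bd / ν) ρ)
      (ε / (lipConst (Bd / ν) ρ (Module.finrank ℝ E) * M + 1))) :
    |G t y - G t c| ≤ ε := by
  have hA : 0 ≤ Bd / ν := div_nonneg hBd0 hν.le
  have hL : 0 < lipConst (Bd / ν) ρ (Module.finrank ℝ E) :=
    lipConst_pos hA hρ (Nat.cast_nonneg _)
  have hLM : 0 < lipConst (Bd / ν) ρ (Module.finrank ℝ E) * M + 1 := by positivity
  have h1 := kernelLimit_space_lipschitz hν ht hτ htT hb hBd hG hM hGM hρ hρτ c y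
    (hy.trans (min_le_left _ _))
  have h2 : ‖y - c‖ ≤ ε / (lipConst (Bd / ν) ρ (Module.finrank ℝ E) * M + 1) :=
    hy.trans (min_le_right _ _)
  calc |G t y - G t c| ≤ lipConst (Bd / ν) ρ (Module.finrank ℝ E) * M * ‖y - c‖ := h1
    _ ≤ lipConst (Bd / ν) ρ (Module.finrank ℝ E) * M *
          (ε / (lipConst (Bd / ν) ρ (Module.finrank ℝ E) * M + 1)) :=
        mul_le_mul_of_nonneg_left h2 (by positivity)
    _ ≤ ε := by
        rw [mul_div_assoc']
        rw [div_le_iff₀ hLM]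
        nlinarith

end General

/-! ### Registered sub-goal (dimension three) -/

/-- **Registered sub-goal `stub_kernelLimit_spaceModulus`** (the `ℝ³` form of
`kernelLimit_space_modulus`; part 2 of the proof of STUB `stub_kernelLimit`): a spatial modulus of
continuity for the slice of an adapted backward kernel at the bottom of an interior block,
depending on the kernel only through a drift bound and a sup bound on the block. -/
theorem stub_kernelLimit_spaceModulus :
    ∀ (ν tₘ T t τ Bd M ρ ε : ℝ) (b : ℝ → EuclideanSpace ℝ (Fin 3) → EuclideanSpace ℝ (Fin 3)) (x₀ : EuclideanSpace ℝ (Fin 3)) (G : ℝ → EuclideanSpace ℝ (Fin 3) → ℝ) (c y : EuclideanSpace ℝ (Fin 3)), 0 < ν → tₘ < t → 0 < τ → t + τ < T → IsSmoothSpaceTimeOn (Ico tₘ T) b → (∀ s ∈ Icc t (t + τ), ∀ x, ‖b s x‖ ≤ Bd) → 0 ≤ Bd → IsAdaptedBackwardKernel ν b (Ico tₘ T) T x₀ G → 0 < M → (∀ s ∈ Icc t (t + τ), ∀ x, |G s x| ≤ M) → 0 < ρ → ρ ^ 2 ≤ ν * τ → 0 < ε → ‖y - c‖ ≤ min (lipRad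 (Bd / ν) ρ) (ε / (lipConst (Bd / ν) ρ 3 * M + 1)) → |G t y - G t c| ≤ ε := by
  intro ν tₘ T t τ Bd M ρ ε b x₀ G c y hν ht hτ htT hb hBd hBd0 hG hM hGM hρ hρτ hε hy
  have h := kernelLimit_space_modulus hν ht hτ htT hb hBd hBd0 hG hM hGM hρ hρτ hε c y
  simp only [finrank_euclideanSpace_fin, Nat.cast_ofNat] at h
  exact h hy

end Summit.NavierStokesRegularity.NavierStokesRegularity.Theorems.AdaptedKernelExists.NashEntropyLastBlock

end
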